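import Literature.Computability.AlgebraicComplexity.PlethysmTableauEvaluation
import Mathlib.GroupTheory.Perm.Fin
import Mathlib.GroupTheory.Perm.Sign
import Mathlib.Data.Fin.Tuple.Basic
import Mathlib.Algebra.BigOperators.Fin
import Mathlib.LinearAlgebra.Matrix.Determinant.Basic
import Mathlib.LinearAlgebra.Matrix.Permanent
import HarnessLib

/-!
# The signed permutation enumerator `permsSign` versus `Equiv.Perm`: sums, determinant, permanent

Proofs file for `PlethysmTableauEvaluation.lean` (Lean checker of the GCT multiplicity-obstruction
engine, cell `pub-gct`; honest framing: rung-1 multiplicity-obstruction search for permanent versus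
determinant at small `(n, m)`, no claim about VP ≠ VNP or P ≠ NP). The executable evaluators of
that file enumerate bijections with the structurally recursive list function `permsSign`
(permute the tail, insert the head at every position, flipping the sign at each step). This file
proves that this enumeration IS the symmetric group with its sign:

* `insertions_ofFn`: `insertions a (ofFn f)` lists `(parity i, ofFn (Fin.insertNth i a f))`,
  `i = 0, …, n`;
* `sum_permsSign_ofFn` (**master lemma**): for any `φ`,
  `∑_{(s, p) ∈ permsSign (ofFn v)} φ s p = ∑_{π : Perm (Fin n)} φ [sign π = -1] (ofFn (v ∘ π))`
  (induction on `n`; the new permutations are `insPerm i π' = ψ(π') * Fin.cycleRange i`, of sign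
  `(-1)^i · sign π'`, `Fin.sign_cycleRange`);
* consequences: `ldet_eq_det` (the Leibniz list determinant of `PlethysmTableauEvaluation` is
  `Matrix.det`) and `lperm_eq_permanent` (the list permanent is `Matrix.permanent`), both for
  square list matrices read through `matOfFn`.

Elementary combinatorics [folklore]; no representation theory here.
-/

open scoped BigOperators

namespace Literature.Computability.AlgebraicComplexity

namespace TableauEval

/-! ## §1 Parity bits -/

/-- The parity bit of a natural number (`true` = odd), by structural recursion. [folklore] -/
def parity : ℕ → Bool
  | 0 => false
  | n + 1 => !parity n

/-- `sgn (parity i) = (-1)^i`. [folklore] -/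
theorem sgn_parity {R : Type*} [Ring R] : ∀ i : ℕ, (sgn (parity i) : R) = (-1) ^ i
  | 0 => by simp [parity, sgn]
  | i + 1 => by
    rw [pow_succ, ← sgn_parity i]
    cases h : parity i <;> simp [parity, sgn, h]

/-- `sgn` of an exclusive or is the product of the signs. [folklore] -/
theorem sgn_xor {R : Type*} [Ring R] (a b : Bool) : (sgn (xor a b) : R) = sgn a * sgn b := by
  cases a <;> cases b <;> simp [sgn]

/-- `sgn` of the sign bit of a permutation is the sign, cast. [folklore] -/
theorem sgn_decide_sign {R : Type*} [CommRing R] {n : ℕ} (π : Equiv.Perm (Fin n)) :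
    (sgn (decide (Equiv.Perm.sign π = -1)) : R) = (Equiv.Perm.sign π : ℤ) := by
  rcases Int.units_eq_one_or (Equiv.Perm.sign π) with h | h <;> simp [sgn, h]

/-! ## §2 `insertions` inserts at every position -/

/-- `insertions a (ofFn f)` is the list of `(parity i, ofFn (Fin.insertNth i a f))` over the
positions `i = 0, …, n`. [folklore] -/
theorem insertions_ofFn {α : Type*} (a : α) : ∀ {n : ℕ} (f : Fin n → α),
    insertions a (List.ofFn f) =
      List.ofFn fun i : Fin (n + 1) => (parity i, List.ofFn (Fin.insertNth i a f))
  | 0, f => by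
    rw [List.ofFn_zero, insertions, List.ofFn_succ, List.ofFn_zero]
    simp [parity, Fin.insertNth_zero']
  | n + 1, f => by
    have hf : f = Fin.cons (f 0) (fun j => f j.succ) := by
      ext j; cases j using Fin.cases <;> simp
    rw [List.ofFn_succ, insertions, insertions_ofFn a (fun i => f i.succ), List.map_ofFn]
    conv_rhs => rw [List.ofFn_succ]
    refine congrArg₂ List.cons ?_ (congrArg List.ofFn (funext fun i => ?_))
    · refine Prod.ext rfl ?_
      change a :: f 0 :: List.ofFn (fun i => f i.succ) = List.ofFn (Fin.insertNth 0 a f)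
      rw [Fin.insertNth_zero', List.ofFn_succ, Fin.cons_zero, List.ofFn_succ]
      simp only [Fin.cons_succ]
    · refine Prod.ext ?_ ?_
      · change (!parity i) = parity (i.succ : ℕ)
        rw [Fin.val_succ]; rfl
      · change f 0 :: List.ofFn (Fin.insertNth i a fun j => f j.succ) =
          List.ofFn (Fin.insertNth i.succ a f)
        conv_rhs => rw [hf, Fin.insertNth_succ_cons, List.ofFn_succ]
        simp only [Fin.cons_zero, Fin.cons_succ]

/-! ## §3 The permutation inserting `0` at position `i` -/

section InsPerm

variable {n : ℕ}

/-- `ψ π'`: the permutation of `Fin (n+1)` fixing `0` and acting by `π'` on the successors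
(Mathlib's `Equiv.Perm.decomposeFin.symm (0, π')`). [folklore] -/
def liftSucc (π' : Equiv.Perm (Fin n)) : Equiv.Perm (Fin (n + 1)) :=
  Equiv.Perm.decomposeFin.symm (0, π')

/-- `liftSucc π' 0 = 0`. [folklore] -/
@[simp]
theorem liftSucc_zero (π' : Equiv.Perm (Fin n)) : liftSucc π' 0 = 0 :=
  Equiv.Perm.decomposeFin_symm_apply_zero 0 π'

/-- `liftSucc π' r.succ = (π' r).succ`. [folklore] -/
@[simp]
theorem liftSucc_succ (π' : Equiv.Perm (Fin n)) (r : Fin n) :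
    liftSucc π' r.succ = (π' r).succ := by
  rw [liftSucc, Equiv.Perm.decomposeFin_symm_apply_succ, Equiv.swap_self, Equiv.refl_apply]

/-- The sign of `liftSucc π'` is the sign of `π'`. [folklore] -/
theorem sign_liftSucc (π' : Equiv.Perm (Fin n)) :
    Equiv.Perm.sign (liftSucc π') = Equiv.Perm.sign π' := by
  rw [liftSucc, Equiv.Perm.decomposeFin.symm_sign, if_pos rfl, one_mul]

/-- **The inserting permutation** `insPerm i π' = liftSucc π' * Fin.cycleRange i`: it sends `i`
to `0` and `i.succAbove r` to `(π' r).succ`. [folklore] -/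
def insPerm (i : Fin (n + 1)) (π' : Equiv.Perm (Fin n)) : Equiv.Perm (Fin (n + 1)) :=
  liftSucc π' * Fin.cycleRange i

/-- `insPerm i π' i = 0`. [folklore] -/
theorem insPerm_apply_self (i : Fin (n + 1)) (π' : Equiv.Perm (Fin n)) : insPerm i π' i = 0 := by
  rw [insPerm, Equiv.Perm.mul_apply, Fin.cycleRange_self, liftSucc_zero]

/-- `insPerm i π' (i.succAbove r) = (π' r).succ`. [folklore] -/
theorem insPerm_apply_succAbove (i : Fin (n + 1)) (π' : Equiv.Perm (Fin n)) (r : Fin n) :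
    insPerm i π' (i.succAbove r) = (π' r).succ := by
  rw [insPerm, Equiv.Perm.mul_apply]
  rcases lt_or_ge (Fin.castSucc r) i with h | h
  · rw [Fin.succAbove_of_castSucc_lt _ _ h, Fin.cycleRange_of_lt h, Fin.coeSucc_eq_succ,
      liftSucc_succ]
  · rw [Fin.succAbove_of_le_castSucc _ _ h,
      Fin.cycleRange_of_gt (lt_of_le_of_lt h Fin.castSucc_lt_succ), liftSucc_succ]

/-- As a function, `insPerm i π'` is `Fin.insertNth i 0 (succ ∘ π')`. [folklore] -/
theorem coe_insPerm (i : Fin (n + 1)) (π' : Equiv.Perm (Fin n)) :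
    ⇑(insPerm i π') = Fin.insertNth i (0 : Fin (n + 1)) fun r => (π' r).succ := by
  funext r
  cases r using Fin.succAboveCases i with
  | x => rw [insPerm_apply_self, Fin.insertNth_apply_same]
  | p r => rw [insPerm_apply_succAbove, Fin.insertNth_apply_succAbove]

/-- Composing a tuple with `insPerm i π'` inserts its value at `0` in position `i`:
`v ∘ insPerm i π' = Fin.insertNth i (v 0) (v ∘ succ ∘ π')`. [folklore] -/
theorem comp_insPerm {α : Type*} (v : Fin (n + 1) → α) (i : Fin (n + 1))
    (π' : Equiv.Perm (Fin n)) :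
    (fun r => v (insPerm i π' r)) = Fin.insertNth i (v 0) fun r => v (π' r).succ := by
  funext r
  cases r using Fin.succAboveCases i with
  | x => rw [insPerm_apply_self, Fin.insertNth_apply_same]
  | p r => rw [insPerm_apply_succAbove, Fin.insertNth_apply_succAbove]

/-- The sign of `insPerm i π'` is `(-1)^i · sign π'`. [folklore] -/
theorem sign_insPerm (i : Fin (n + 1)) (π' : Equiv.Perm (Fin n)) :
    Equiv.Perm.sign (insPerm i π') = (-1) ^ (i : ℕ) * Equiv.Perm.sign π' := by
  rw [insPerm, map_mul, sign_liftSucc, Fin.sign_cycleRange]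
  exact mul_comm _ _

/-- `(i, π') ↦ insPerm i π'` is a bijection `Fin (n+1) × Perm (Fin n) → Perm (Fin (n+1))`.
[folklore] -/
theorem insPerm_bijective :
    Function.Bijective fun x : Fin (n + 1) × Equiv.Perm (Fin n) => insPerm x.1 x.2 := by
  rw [Fintype.bijective_iff_injective_and_card]
  refine ⟨?_, by simp [Fintype.card_perm, Fintype.card_prod, Nat.factorial_succ]⟩
  rintro ⟨i, π'⟩ ⟨j, ρ'⟩ h
  simp only at h
  have hij : i = j := by
    have h1 := insPerm_apply_self j ρ'
    rw [← h] at h1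
    -- `insPerm i π' j = 0` forces `j = i`
    by_contra hne
    obtain ⟨r, rfl⟩ := Fin.exists_succAbove_eq (Ne.symm hne)
    rw [insPerm_apply_succAbove] at h1
    exact Fin.succ_ne_zero _ h1
  subst hij
  have hπ : π' = ρ' := by
    ext r
    have h2 := congrArg (fun σ : Equiv.Perm (Fin (n + 1)) => σ (i.succAbove r)) h
    simp only [insPerm_apply_succAbove] at h2
    exact congrArg Fin.val (Fin.succ_injective _ h2)
  rw [hπ]

end InsPerm

/-! ## §4 The master lemma -/

/-- Sums over a `flatMap` of mapped lists. [folklore] -/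
theorem sum_map_flatMap {α β M : Type*} [AddCommMonoid M] (l : List α) (g : α → List β)
    (f : β → M) : ((l.flatMap g).map f).sum = (l.map fun a => ((g a).map f).sum).sum := by
  induction l with
  | nil => simp
  | cons a l ih => simp [List.flatMap_cons, List.sum_append, ih]

/-- `(-1)^i` in `ℤˣ` is `-1` or `1` according to the parity bit. [folklore] -/
theorem neg_one_pow_eq_parity (i : ℕ) : ((-1 : ℤˣ) ^ i) = if parity i then -1 else 1 := by
  induction i with
  | zero => simp [parity]
  | succ i ih =>
    have h1 : ((-1 : ℤˣ) ^ (i + 1)) = (-1 : ℤˣ) ^ i * (-1) := pow_succ _ _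
    rw [h1, ih]
    cases h : parity i <;> simp [parity, h]

/-- The sign bit of `(-1)^i · s` is the sign bit of `s` xor the parity of `i`. [folklore] -/
theorem decide_neg_one_pow_mul (i : ℕ) (s : ℤˣ) :
    decide ((-1 : ℤˣ) ^ i * s = -1) = xor (decide (s = -1)) (parity i) := by
  rw [neg_one_pow_eq_parity]
  rcases Int.units_eq_one_or s with rfl | rfl <;> cases parity i <;> simp [Units.ext_iff]

/-- **Master lemma**: summing any function over the signed enumeration `permsSign (ofFn v)` is
summing over the symmetric group `Perm (Fin n)` with the sign bit `[sign π = -1]` and the permuted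
tuple `ofFn (v ∘ π)`. [folklore] -/
theorem sum_permsSign_ofFn {α M : Type*} [AddCommMonoid M] :
    ∀ {n : ℕ} (v : Fin n → α) (φ : Bool × List α → M),
      ((permsSign (List.ofFn v)).map φ).sum =
        ∑ π : Equiv.Perm (Fin n),
          φ (decide (Equiv.Perm.sign π = -1), List.ofFn fun r => v (π r))
  | 0, v, φ => by
    rw [List.ofFn_zero, permsSign, Fintype.sum_unique]
    simp [Units.ext_iff]
  | n + 1, v, φ => by
    rw [List.ofFn_succ, permsSign, sum_map_flatMap]
    have IH := sum_permsSign_ofFn (fun i => v i.succ)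
      (fun q => ((insertions (v 0) q.2).map fun r => φ (xor q.1 r.1, r.2)).sum)
    simp only [List.map_map, Function.comp_def] at IH ⊢
    rw [IH]
    have hL : ∀ π' : Equiv.Perm (Fin n),
        ((insertions (v 0) (List.ofFn fun x => v (π' x).succ)).map
            fun r => φ (xor (decide (Equiv.Perm.sign π' = -1)) r.1, r.2)).sum =
          ∑ i : Fin (n + 1), φ (xor (decide (Equiv.Perm.sign π' = -1)) (parity i),
            List.ofFn (Fin.insertNth i (v 0) fun r => v (π' r).succ)) := by
      intro π'
      rw [insertions_ofFn, List.map_ofFn, List.sum_ofFn]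
      rfl
    simp only [hL]
    rw [← (Equiv.ofBijective _ insPerm_bijective).sum_comp, Fintype.sum_prod_type,
      Finset.sum_comm]
    refine Finset.sum_congr rfl fun i _ => Finset.sum_congr rfl fun π' _ => ?_
    simp only [Equiv.ofBijective_apply, comp_insPerm, sign_insPerm, decide_neg_one_pow_mul]

/-- Unsigned form of the master lemma (the function ignores the sign bit). [folklore] -/
theorem sum_permsSign_ofFn' {α M : Type*} [AddCommMonoid M] {n : ℕ} (v : Fin n → α)
    (φ : List α → M) :
    ((permsSign (List.ofFn v)).map fun q => φ q.2).sum =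
      ∑ π : Equiv.Perm (Fin n), φ (List.ofFn fun r => v (π r)) :=
  sum_permsSign_ofFn v fun q => φ q.2

/-! ## §5 Consequences: `ldet` is `Matrix.det`, `lperm` is `Matrix.permanent` -/

section DetPerm

variable {R : Type*} [CommRing R]

/-- The square matrix read off a list of rows (entries `getD · 0`, rows `getD · []`). [folklore] -/
def matOfRows (n : ℕ) (L : List (List R)) : Matrix (Fin n) (Fin n) R :=
  Matrix.of fun i j => (L.getD i []).getD j 0

/-- `zipWith` of two `ofFn` lists. [folklore] -/
theorem zipWith_ofFn {α β γ : Type*} (f : α → β → γ) :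
    ∀ {n : ℕ} (g : Fin n → α) (h : Fin n → β),
      List.zipWith f (List.ofFn g) (List.ofFn h) = List.ofFn fun i => f (g i) (h i)
  | 0, g, h => by simp
  | n + 1, g, h => by
    rw [List.ofFn_succ, List.ofFn_succ, List.zipWith_cons_cons, zipWith_ofFn, List.ofFn_succ]

/-- `List.range n` is `ofFn` of the coercion `Fin n → ℕ`. [folklore] -/
theorem range_eq_ofFn : ∀ n : ℕ, List.range n = List.ofFn fun i : Fin n => (i : ℕ)
  | 0 => by simp
  | n + 1 => by
    rw [List.range_succ_eq_map, range_eq_ofFn n, List.ofFn_succ, List.map_ofFn]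
    rfl

/-- Row lookups along an `ofFn` list of column indices. [folklore] -/
theorem zipWith_getD_ofFn : ∀ (L : List (List R)) (c : Fin L.length → ℕ),
    List.zipWith (fun row j => row.getD j 0) L (List.ofFn c) =
      List.ofFn fun i => (L.getD i []).getD (c i) 0
  | [], c => by simp
  | row :: rest, c => by
    rw [List.ofFn_succ, List.zipWith_cons_cons, zipWith_getD_ofFn rest (fun i => c i.succ),
      List.ofFn_succ]
    simp

/-- **The Leibniz list determinant is `Matrix.det`.** [folklore] -/
theorem ldet_eq_det (L : List (List R)) {n : ℕ} (hL : L.length = n) :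
    ldet L = (matOfRows n L).det := by
  subst hL
  unfold ldet
  rw [range_eq_ofFn, sum_permsSign_ofFn, ← Matrix.det_transpose, Matrix.det_apply']
  refine Finset.sum_congr rfl fun π _ => ?_
  rw [sgn_decide_sign]
  congr 1
  rw [zipWith_getD_ofFn, List.prod_ofFn]
  rfl

/-- **The list permanent is `Matrix.permanent`.** [folklore] -/
theorem lperm_eq_permanent (L : List (List R)) {n : ℕ} (hL : L.length = n) :
    lperm L = (matOfRows n L).permanent := by
  subst hL
  unfold lperm
  rw [range_eq_ofFn, sum_permsSign_ofFn, ← Matrix.permanent_transpose, Matrix.permanent]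
  refine Finset.sum_congr rfl fun π _ => ?_
  rw [zipWith_getD_ofFn, List.prod_ofFn]
  rfl

end DetPerm

end TableauEval

end Literature.Computability.AlgebraicComplexity
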